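import Mathlib.Analysis.SpecialFunctions.Log.Basic
import Mathlib.Algebra.BigOperators.Fin
import Mathlib.Data.Fintype.BigOperators
import Mathlib.Logic.Equiv.Fin.Basic
import HarnessLib

/-!
# A finite product-probability toolkit (for Garlík's random restriction)

Support file for the proof of `levelledRefCNF_lowerBound` ([Garlík 2019, Thm 1]). The random
restriction of [Garlík 2019, Def. 9] lives on a finite product space; its analysis
([Garlík 2019, Lemmas 10 and 14]) uses only: linearity and monotonicity of expectation, the
union bound, Fubini / conditioning on some of the coordinates, the product rule for
independent coordinates, a sequential ("adapted events") product bound, and the exponential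
moment (Chernoff) bound for sums of independent indicator bits. This file provides exactly
these, for probability mass functions with real weights on `Fintype`s (`FinProb`), avoiding
measure theory:

* `FinProb α` (weights `w ≥ 0` summing to `1`), expectation `ex`, probability `pr`, union
  bound `pr_exists_le`, existence from `pr < 1` (`exists_not_of_pr_lt_one`);
* `bernoulli`, `uniform`, binary products `prod` (Fubini `ex_prod`, conditioning
  `pr_prod_le_left/right`), finite products `pi` of a family indexed by a `Fintype`
  (product rule `ex_pi_prod`, `pr_pi_forall`; conditioning on one coordinate `ex_pi_update`,
  `pr_pi_le_update`);
* the sequential bound `pr_seq_le` on `Fin N → α`: adapted events each of conditional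
  probability `≤ q` have joint probability `≤ q ^ (number of events)`;
* the Chernoff bound `pr_card_le_exp` for the number of successes among independent bits.

## References

* M. Garlík, *Resolution lower bounds for refutation statements*, arXiv:1905.12372, §4
  (Lemmas 10, 14: "by the Chernoff bound and the union bound").
* M. Mitzenmacher, E. Upfal, *Probability and Computing*, 2nd ed., CUP 2017, Thm 4.4
  (Chernoff bound via moment generating functions). [folklore]
-/

namespace Literature.Computability.MetaComplexity

namespace LevelledRefCNF

open Finset

/-- A probability mass function with real weights on a finite type. [folklore] -/
structure FinProb (α : Type*) [Fintype α] where
  /-- the weight (probability) of a point -/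
  w : α → ℝ
  /-- weights are nonnegative -/
  w_nonneg : ∀ a, 0 ≤ w a
  /-- weights sum to one -/
  w_sum : ∑ a, w a = 1

namespace FinProb

variable {α β : Type*} [Fintype α] [Fintype β]

/-! ### Expectation and probability -/

/-- Expectation of a real function. [folklore] -/
def ex (μ : FinProb α) (g : α → ℝ) : ℝ :=
  ∑ a, μ.w a * g a

open Classical in
/-- Probability of an event (classical decidability). [folklore] -/
noncomputable def pr (μ : FinProb α) (A : α → Prop) : ℝ :=
  μ.ex fun a => if A a then 1 else 0

/-- Expectation is monotone. [folklore] -/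
theorem ex_mono (μ : FinProb α) {g h : α → ℝ} (hle : ∀ a, g a ≤ h a) : μ.ex g ≤ μ.ex h :=
  sum_le_sum fun a _ => mul_le_mul_of_nonneg_left (hle a) (μ.w_nonneg a)

/-- Expectation of a constant. [folklore] -/
theorem ex_const (μ : FinProb α) (c : ℝ) : μ.ex (fun _ => c) = c := by
  unfold ex
  rw [← sum_mul, μ.w_sum, one_mul]

/-- Expectation is bounded by a pointwise bound. [folklore] -/
theorem ex_le_of_le (μ : FinProb α) {g : α → ℝ} {c : ℝ} (h : ∀ a, g a ≤ c) : μ.ex g ≤ c :=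
  (μ.ex_mono h).trans (μ.ex_const c).le

/-- Expectation of a nonnegative function is nonnegative. [folklore] -/
theorem ex_nonneg (μ : FinProb α) {g : α → ℝ} (h : ∀ a, 0 ≤ g a) : 0 ≤ μ.ex g :=
  (μ.ex_const 0).symm.le.trans (μ.ex_mono h)

/-- Expectation is additive. [folklore] -/
theorem ex_add (μ : FinProb α) (g h : α → ℝ) :
    μ.ex (fun a => g a + h a) = μ.ex g + μ.ex h := by
  unfold ex
  rw [← sum_add_distrib]
  exact sum_congr rfl fun a _ => by ring

/-- Expectation is homogeneous. [folklore] -/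
theorem ex_mul_left (μ : FinProb α) (c : ℝ) (g : α → ℝ) :
    μ.ex (fun a => c * g a) = c * μ.ex g := by
  unfold ex
  rw [mul_sum]
  exact sum_congr rfl fun a _ => by ring

/-- Expectation of a finite sum of functions. [folklore] -/
theorem ex_sum (μ : FinProb α) {ι : Type*} (S : Finset ι) (g : ι → α → ℝ) :
    μ.ex (fun a => ∑ i ∈ S, g i a) = ∑ i ∈ S, μ.ex (g i) := by
  unfold ex
  simp_rw [mul_sum]
  rw [sum_comm]

/-- Probability as the expectation of the indicator. [folklore] -/
theorem pr_eq_ex (μ : FinProb α) (A : α → Prop) [DecidablePred A] :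
    μ.pr A = μ.ex fun a => if A a then 1 else 0 := by
  unfold pr
  congr 1
  funext a
  congr 1

/-- Probabilities are nonnegative. [folklore] -/
theorem pr_nonneg (μ : FinProb α) (A : α → Prop) : 0 ≤ μ.pr A := by
  classical
  rw [pr_eq_ex]
  exact μ.ex_nonneg fun a => by split_ifs <;> norm_num

/-- Probabilities are at most one. [folklore] -/
theorem pr_le_one (μ : FinProb α) (A : α → Prop) : μ.pr A ≤ 1 := by
  classical
  rw [pr_eq_ex]
  exact μ.ex_le_of_le fun a => by split_ifs <;> norm_num

/-- Probability is monotone. [folklore] -/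
theorem pr_mono (μ : FinProb α) {A B : α → Prop} (h : ∀ a, A a → B a) : μ.pr A ≤ μ.pr B := by
  classical
  rw [pr_eq_ex, pr_eq_ex]
  refine μ.ex_mono fun a => ?_
  by_cases hA : A a
  · simp [hA, h a hA]
  · by_cases hB : B a <;> simp [hA, hB]

/-- Equivalent events have the same probability. [folklore] -/
theorem pr_congr (μ : FinProb α) {A B : α → Prop} (h : ∀ a, A a ↔ B a) : μ.pr A = μ.pr B :=
  le_antisymm (μ.pr_mono fun a => (h a).1) (μ.pr_mono fun a => (h a).2)

/-- The sure event has probability one. [folklore] -/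
theorem pr_true (μ : FinProb α) : μ.pr (fun _ => True) = 1 := by
  classical
  rw [pr_eq_ex]
  simp only [if_true]
  exact μ.ex_const 1

/-- A probability is bounded by the expectation of any nonnegative function that is `≥ 1` on
the event (Markov-type bound). [folklore] -/
theorem pr_le_ex (μ : FinProb α) {A : α → Prop} {g : α → ℝ} (h1 : ∀ a, A a → 1 ≤ g a)
    (h0 : ∀ a, 0 ≤ g a) : μ.pr A ≤ μ.ex g := by
  classical
  rw [pr_eq_ex]
  refine μ.ex_mono fun a => ?_
  split_ifs with hA
  · exact h1 a hA
  · exact h0 a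

/-- **Union bound.** [folklore] -/
theorem pr_exists_le (μ : FinProb α) {ι : Type*} (S : Finset ι) (A : ι → α → Prop) :
    μ.pr (fun a => ∃ i ∈ S, A i a) ≤ ∑ i ∈ S, μ.pr (A i) := by
  classical
  simp_rw [pr_eq_ex]
  rw [← μ.ex_sum]
  refine μ.ex_mono fun a => ?_
  split_ifs with h
  · obtain ⟨i, hi, hA⟩ := h
    calc (1 : ℝ) = if A i a then 1 else 0 := by simp [hA]
      _ ≤ ∑ i ∈ S, if A i a then (1 : ℝ) else 0 :=
        single_le_sum (f := fun i => if A i a then (1 : ℝ) else 0)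
          (fun j _ => by split_ifs <;> norm_num) hi
  · exact sum_nonneg fun i _ => by split_ifs <;> norm_num

/-- Union bound for two events. [folklore] -/
theorem pr_or_le (μ : FinProb α) (A B : α → Prop) :
    μ.pr (fun a => A a ∨ B a) ≤ μ.pr A + μ.pr B := by
  classical
  rw [pr_eq_ex, pr_eq_ex, pr_eq_ex, ← ex_add]
  refine μ.ex_mono fun a => ?_
  by_cases hA : A a <;> by_cases hB : B a <;> simp [hA, hB]

/-- Bound for an event contained in the union of two events. [folklore] -/
theorem pr_le_add_of_imp (μ : FinProb α) {C A B : α → Prop} (h : ∀ a, C a → A a ∨ B a) :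
    μ.pr C ≤ μ.pr A + μ.pr B :=
  (μ.pr_mono h).trans (μ.pr_or_le A B)

/-- **The probabilistic method**: an event of probability `< 1` fails somewhere. [folklore] -/
theorem exists_not_of_pr_lt_one (μ : FinProb α) {A : α → Prop} (h : μ.pr A < 1) : ∃ a, ¬ A a := by
  by_contra hall
  push Not at hall
  have : μ.pr A = 1 := by
    rw [← μ.pr_true]
    exact μ.pr_congr fun a => by simp [hall a]
  rw [this] at h
  exact lt_irrefl _ h

/-! ### Bernoulli and uniform distributions -/

/-- The Bernoulli distribution with success probability `p ∈ [0,1]`. [folklore] -/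
def bernoulli (p : ℝ) (h0 : 0 ≤ p) (h1 : p ≤ 1) : FinProb Bool where
  w b := if b then p else 1 - p
  w_nonneg b := by cases b <;> simp [h0, h1]
  w_sum := by simp

/-- Expectation under the Bernoulli distribution. [folklore] -/
theorem ex_bernoulli {p : ℝ} (h0 : 0 ≤ p) (h1 : p ≤ 1) (g : Bool → ℝ) :
    (bernoulli p h0 h1).ex g = p * g true + (1 - p) * g false := by
  simp [ex, bernoulli]

/-- Probability of success under the Bernoulli distribution. [folklore] -/
theorem pr_bernoulli_true {p : ℝ} (h0 : 0 ≤ p) (h1 : p ≤ 1) :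
    (bernoulli p h0 h1).pr (fun b => b = true) = p := by
  classical
  rw [pr_eq_ex, ex_bernoulli]
  simp

/-- The uniform distribution on a nonempty finite type. [folklore] -/
noncomputable def uniform (α : Type*) [Fintype α] [Nonempty α] : FinProb α where
  w _ := 1 / Fintype.card α
  w_nonneg _ := by positivity
  w_sum := by
    rw [sum_const, card_univ, nsmul_eq_mul]
    have : (Fintype.card α : ℝ) ≠ 0 := by exact_mod_cast Fintype.card_ne_zero
    field_simp

/-- Expectation under the uniform distribution. [folklore] -/
theorem ex_uniform [Nonempty α] (g : α → ℝ) :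
    (uniform α).ex g = (∑ a, g a) / Fintype.card α := by
  simp only [ex, uniform]
  rw [← mul_sum]
  ring

/-- Probability under the uniform distribution: the proportion of the event. [folklore] -/
theorem pr_uniform [Nonempty α] (A : α → Prop) [DecidablePred A] :
    (uniform α).pr A = ((univ.filter A).card : ℝ) / Fintype.card α := by
  rw [pr_eq_ex, ex_uniform]
  congr 1
  rw [sum_boole]

/-- Lower bound for a uniform probability from a lower bound on the size of the event.
[folklore] -/
theorem le_pr_uniform [Nonempty α] (A : α → Prop) [DecidablePred A] {c : ℝ}
    (h : c * Fintype.card α ≤ (univ.filter A).card) : c ≤ (uniform α).pr A := by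
  rw [pr_uniform, le_div_iff₀ (by exact_mod_cast Fintype.card_pos)]
  exact h

/-! ### Binary products -/

/-- The product of two distributions (independent coordinates). [folklore] -/
def prod (μ : FinProb α) (ν : FinProb β) : FinProb (α × β) where
  w x := μ.w x.1 * ν.w x.2
  w_nonneg x := mul_nonneg (μ.w_nonneg _) (ν.w_nonneg _)
  w_sum := by
    rw [Fintype.sum_prod_type]
    simp only
    rw [← sum_mul_sum, μ.w_sum, ν.w_sum, one_mul]

/-- **Fubini**, integrating the second coordinate first. [folklore] -/
theorem ex_prod (μ : FinProb α) (ν : FinProb β) (g : α × β → ℝ) :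
    (μ.prod ν).ex g = μ.ex fun a => ν.ex fun b => g (a, b) := by
  simp only [ex, prod]
  rw [Fintype.sum_prod_type]
  refine sum_congr rfl fun a _ => ?_
  rw [mul_sum]
  exact sum_congr rfl fun b _ => by ring

/-- **Fubini**, integrating the first coordinate first. [folklore] -/
theorem ex_prod' (μ : FinProb α) (ν : FinProb β) (g : α × β → ℝ) :
    (μ.prod ν).ex g = ν.ex fun b => μ.ex fun a => g (a, b) := by
  rw [ex_prod]
  simp only [ex]
  simp_rw [mul_sum]
  rw [sum_comm]
  exact sum_congr rfl fun b _ => sum_congr rfl fun a _ => by ring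

/-- **Conditioning on the second coordinate**: a bound valid for every value of the second
coordinate is a bound for the product. [folklore] -/
theorem pr_prod_le_left (μ : FinProb α) (ν : FinProb β) {A : α × β → Prop} {c : ℝ}
    (h : ∀ b, μ.pr (fun a => A (a, b)) ≤ c) : (μ.prod ν).pr A ≤ c := by
  classical
  rw [pr_eq_ex, ex_prod']
  refine ν.ex_le_of_le fun b => ?_
  have := h b
  rwa [pr_eq_ex] at this

/-- **Conditioning on the first coordinate.** [folklore] -/
theorem pr_prod_le_right (μ : FinProb α) (ν : FinProb β) {A : α × β → Prop} {c : ℝ}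
    (h : ∀ a, ν.pr (fun b => A (a, b)) ≤ c) : (μ.prod ν).pr A ≤ c := by
  classical
  rw [pr_eq_ex, ex_prod]
  refine μ.ex_le_of_le fun a => ?_
  have := h a
  rwa [pr_eq_ex] at this

/-- An event of the first coordinate has its own probability. [folklore] -/
theorem pr_prod_fst (μ : FinProb α) (ν : FinProb β) (A : α → Prop) :
    (μ.prod ν).pr (fun x => A x.1) = μ.pr A := by
  classical
  rw [pr_eq_ex, ex_prod, pr_eq_ex]
  congr 1
  funext a
  exact ν.ex_const (if A a then 1 else 0)

/-- An event of the second coordinate has its own probability. [folklore] -/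
theorem pr_prod_snd (μ : FinProb α) (ν : FinProb β) (B : β → Prop) :
    (μ.prod ν).pr (fun x => B x.2) = ν.pr B := by
  classical
  rw [pr_eq_ex, ex_prod', pr_eq_ex]
  congr 1
  funext b
  exact μ.ex_const (if B b then 1 else 0)

/-! ### Finite products -/

section Pi

variable {ι : Type*} [Fintype ι] [DecidableEq ι] {κ : Type*} [Fintype κ]

/-- The product of a finite family of distributions on `κ` (independent coordinates indexed
by `ι`). [folklore] -/
def pi (μ : ι → FinProb κ) : FinProb (ι → κ) where
  w f := ∏ i, (μ i).w (f i)
  w_nonneg f := prod_nonneg fun i _ => (μ i).w_nonneg _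
  w_sum := by
    rw [← Fintype.prod_sum fun i a => (μ i).w a]
    simp [FinProb.w_sum]

/-- **Product rule**: the expectation of a product of coordinate functions is the product of
the expectations. [folklore] -/
theorem ex_pi_prod (μ : ι → FinProb κ) (g : ι → κ → ℝ) :
    (pi μ).ex (fun f => ∏ i, g i (f i)) = ∏ i, (μ i).ex (g i) := by
  simp only [ex, pi]
  rw [Fintype.prod_sum fun i a => (μ i).w a * g i a]
  refine sum_congr rfl fun f _ => ?_
  rw [prod_mul_distrib]

/-- **Product rule for events**: coordinatewise events on a set `S` of coordinates are
independent. [folklore] -/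
theorem pr_pi_forall (μ : ι → FinProb κ) (S : Finset ι) (A : ι → κ → Prop) :
    (pi μ).pr (fun f => ∀ i ∈ S, A i (f i)) = ∏ i ∈ S, (μ i).pr (A i) := by
  classical
  have key : ∀ f : ι → κ, (if ∀ i ∈ S, A i (f i) then (1 : ℝ) else 0) =
      ∏ i, if i ∈ S then (if A i (f i) then (1 : ℝ) else 0) else 1 := by
    intro f
    split_ifs with h
    · exact (prod_eq_one fun i _ => by
        by_cases hi : i ∈ S
        · simp [hi, h i hi]
        · simp [hi]).symm
    · push Not at h
      obtain ⟨i, hi, hA⟩ := h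
      exact (prod_eq_zero (mem_univ i) (by simp [hi, hA])).symm
  rw [pr_eq_ex]
  simp_rw [key]
  rw [ex_pi_prod μ fun i a => if i ∈ S then (if A i a then (1 : ℝ) else 0) else 1]
  have hfac : ∀ i, (μ i).ex (fun a => if i ∈ S then (if A i a then (1 : ℝ) else 0) else 1) =
      if i ∈ S then (μ i).pr (A i) else 1 := by
    intro i
    by_cases hi : i ∈ S
    · simp only [hi, if_true]
      rw [pr_eq_ex]
    · simp only [hi, if_false]
      exact (μ i).ex_const 1
  rw [Fintype.prod_congr _ _ hfac, prod_ite_mem, univ_inter]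

omit [Fintype ι] [Fintype κ] in
/-- Splitting a function at a coordinate: the value at `i` and the rest. [folklore] -/
theorem funSplitAt_symm_self (i : ι) (a : κ) (g : {j // j ≠ i} → κ) :
    (Equiv.funSplitAt i κ).symm (a, g) i = a := by
  simp [Equiv.funSplitAt_symm_apply]

omit [Fintype ι] [Fintype κ] in
/-- Splitting a function at a coordinate: the other values. [folklore] -/
theorem funSplitAt_symm_ne (i : ι) (a : κ) (g : {j // j ≠ i} → κ) {j : ι} (hj : j ≠ i) :
    (Equiv.funSplitAt i κ).symm (a, g) j = g ⟨j, hj⟩ := by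
  simp [Equiv.funSplitAt_symm_apply, hj]

omit [Fintype ι] [Fintype κ] in
/-- Updating the split coordinate. [folklore] -/
theorem update_funSplitAt_symm (i : ι) (a b : κ) (g : {j // j ≠ i} → κ) :
    Function.update ((Equiv.funSplitAt i κ).symm (a, g)) i b = (Equiv.funSplitAt i κ).symm (b, g) := by
  funext j
  by_cases hj : j = i
  · subst hj; simp [Equiv.funSplitAt_symm_apply]
  · rw [Function.update_of_ne hj, funSplitAt_symm_ne i a g hj, funSplitAt_symm_ne i b g hj]

/-- The product weight factors at a coordinate. [folklore] -/
theorem w_pi_funSplitAt_symm (μ : ι → FinProb κ) (i : ι) (a : κ) (g : {j // j ≠ i} → κ) :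
    (pi μ).w ((Equiv.funSplitAt i κ).symm (a, g)) = (μ i).w a * ∏ j : {j // j ≠ i}, (μ j).w (g j) := by
  simp only [pi]
  rw [← mul_prod_erase univ _ (mem_univ i), funSplitAt_symm_self]
  congr 1
  rw [prod_subtype (univ.erase i) (p := fun j => j ≠ i) (by simp)]
  exact Fintype.prod_congr _ _ fun j => by rw [funSplitAt_symm_ne i a g j.2]

/-- **Conditioning on one coordinate (tower property)**: averaging first over coordinate `i`
with the others fixed does not change the expectation. [folklore] -/
theorem ex_pi_update (μ : ι → FinProb κ) (i : ι) (g : (ι → κ) → ℝ) :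
    (pi μ).ex g = (pi μ).ex fun f => (μ i).ex fun a => g (Function.update f i a) := by
  have expand : ∀ G : (ι → κ) → ℝ, (pi μ).ex G =
      ∑ a : κ, ∑ r : {j // j ≠ i} → κ, (μ i).w a * (∏ j : {j // j ≠ i}, (μ j.1).w (r j)) *
        G ((Equiv.funSplitAt i κ).symm (a, r)) := by
    intro G
    unfold ex
    rw [Fintype.sum_equiv (Equiv.funSplitAt i κ) _
      (fun x => (pi μ).w ((Equiv.funSplitAt i κ).symm x) * G ((Equiv.funSplitAt i κ).symm x))
      (fun f => by rw [Equiv.symm_apply_apply]), Fintype.sum_prod_type]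
    refine sum_congr rfl fun a _ => sum_congr rfl fun r _ => ?_
    rw [w_pi_funSplitAt_symm]
  rw [expand, expand]
  -- on the right, the inner expectation does not depend on `a`
  have inner : ∀ (a : κ) (r : {j // j ≠ i} → κ),
      (μ i).ex (fun b => g (Function.update ((Equiv.funSplitAt i κ).symm (a, r)) i b)) =
        ∑ b, (μ i).w b * g ((Equiv.funSplitAt i κ).symm (b, r)) := by
    intro a r
    unfold ex
    exact sum_congr rfl fun b _ => by dsimp only; rw [update_funSplitAt_symm]
  simp_rw [inner]
  rw [sum_comm]
  conv_rhs => rw [sum_comm]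
  refine sum_congr rfl fun r _ => ?_
  rw [← sum_mul, ← sum_mul, (μ i).w_sum, one_mul, mul_sum]
  exact sum_congr rfl fun a _ => by ring

/-- **Conditioning on one coordinate, for probabilities**: if for every configuration of the
other coordinates the conditional probability of `A` is `≤ c`, then `pr A ≤ c`. [folklore] -/
theorem pr_pi_le_update (μ : ι → FinProb κ) (i : ι) {A : (ι → κ) → Prop} {c : ℝ}
    (h : ∀ f, (μ i).pr (fun a => A (Function.update f i a)) ≤ c) : (pi μ).pr A ≤ c := by
  classical
  rw [pr_eq_ex, ex_pi_update μ i]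
  refine (pi μ).ex_le_of_le fun f => ?_
  have := h f
  rwa [pr_eq_ex] at this

end Pi

/-! ### The sequential bound for adapted events -/

section Seq

variable {κ : Type*} [Fintype κ]

/-- The product weight on `Fin (N+1) → κ` factors through `Fin.snoc`. [folklore] -/
theorem w_pi_snoc (μ : FinProb κ) {N : ℕ} (g : Fin N → κ) (a : κ) :
    (pi fun _ : Fin (N + 1) => μ).w (Fin.snoc g a) = (pi fun _ : Fin N => μ).w g * μ.w a := by
  simp only [pi]
  rw [Fin.prod_univ_castSucc]
  simp [Fin.snoc_castSucc, Fin.snoc_last]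

/-- Expectation on `Fin (N+1) → κ` by integrating the last coordinate separately.
[folklore] -/
theorem ex_pi_succ (μ : FinProb κ) {N : ℕ} (G : (Fin (N + 1) → κ) → ℝ) :
    (pi fun _ : Fin (N + 1) => μ).ex G =
      (pi fun _ : Fin N => μ).ex fun g => μ.ex fun a => G (Fin.snoc g a) := by
  unfold ex
  rw [Fintype.sum_equiv (Fin.snocEquiv fun _ => κ).symm _
    (fun x : κ × (Fin N → κ) => (pi fun _ : Fin (N + 1) => μ).w (Fin.snoc x.2 x.1) *
      G (Fin.snoc x.2 x.1)) (fun f => by simp [Fin.snocEquiv]),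
    Fintype.sum_prod_type, sum_comm]
  refine sum_congr rfl fun g _ => ?_
  rw [mul_sum]
  refine sum_congr rfl fun a _ => ?_
  rw [w_pi_snoc]
  ring

/-- **Sequential bound for adapted events.** On `Fin N → κ` with i.i.d. coordinates, let
`F j` be events such that `F j` only depends on the coordinates `≤ j`, and such that for every
`j ∈ U` the conditional probability of `F j` given the coordinates `< j` is at most `q`. Then
all the `F j`, `j ∈ U`, happen simultaneously with probability at most `q ^ |U|`.
(The chain rule for the nested conditioning in [Garlík 2019, proof of Lemma 14 (iv)].)
[cite: Garlik2019, Lemma 14 (proof of (iv), the bound on event (b))] -/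
theorem pr_seq_le (μ : FinProb κ) [Nonempty κ] {q : ℝ} (hq : 0 ≤ q) :
    ∀ (N : ℕ) (U : Finset (Fin N)) (F : Fin N → (Fin N → κ) → Prop),
      (∀ j f g, (∀ k, k ≤ j → f k = g k) → (F j f ↔ F j g)) →
      (∀ j ∈ U, ∀ f, μ.pr (fun a => F j (Function.update f j a)) ≤ q) →
      (pi fun _ : Fin N => μ).pr (fun f => ∀ j ∈ U, F j f) ≤ q ^ U.card := by
  classical
  intro N
  induction N with
  | zero =>
    intro U F _ _
    have hU : U = ∅ := eq_empty_of_forall_notMem fun j => j.elim0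
    subst hU
    simpa using (pi fun _ : Fin 0 => μ).pr_le_one _
  | succ N ih =>
    intro U F hadapt hcond
    obtain ⟨a₀⟩ := ‹Nonempty κ›
    -- the events not at the last coordinate, seen on `Fin N → κ`
    set U' : Finset (Fin N) := univ.filter fun j' => j'.castSucc ∈ U with hU'
    set F' : Fin N → (Fin N → κ) → Prop := fun j' g => F j'.castSucc (Fin.snoc g a₀) with hF'
    have hadapt' : ∀ j' f g, (∀ k, k ≤ j' → f k = g k) → (F' j' f ↔ F' j' g) := by
      intro j' f g hfg
      apply hadapt
      intro k hk
      rcases Fin.eq_castSucc_or_eq_last k with ⟨k', rfl⟩ | rfl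
      · simp only [Fin.snoc_castSucc]
        exact hfg k' (by simpa using hk)
      · exact absurd hk (not_le.2 (Fin.castSucc_lt_last j'))
    have hcond' : ∀ j' ∈ U', ∀ g, μ.pr (fun a => F' j' (Function.update g j' a)) ≤ q := by
      intro j' hj' g
      simp only [hU', mem_filter, mem_univ, true_and] at hj'
      have := hcond _ hj' (Fin.snoc g a₀)
      refine le_of_eq_of_le (μ.pr_congr fun a => ?_) this
      simp only [hF']
      rw [Fin.snoc_update]
    have hIH := ih U' F' hadapt' hcond'
    -- freeze the last coordinate in the earlier events
    have hfreeze : ∀ (g : Fin N → κ) (a : κ) (j' : Fin N),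
        F j'.castSucc (Fin.snoc g a) ↔ F' j' g := by
      intro g a j'
      apply hadapt
      intro k hk
      rcases Fin.eq_castSucc_or_eq_last k with ⟨k', rfl⟩ | rfl
      · simp [Fin.snoc_castSucc]
      · exact absurd hk (not_le.2 (Fin.castSucc_lt_last j'))
    -- decompose the probability along the last coordinate
    rw [pr_eq_ex, ex_pi_succ]
    by_cases hlast : Fin.last N ∈ U
    · -- `|U| = |U'| + 1`
      have hcard : U.card = U'.card + 1 := by
        have : U = insert (Fin.last N) (U'.map Fin.castSuccEmb) := by
          ext k
          simp only [mem_insert, mem_map, hU', mem_filter, mem_univ, true_and,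
            Fin.castSuccEmb_apply]
          constructor
          · intro hk
            rcases Fin.eq_castSucc_or_eq_last k with ⟨k', rfl⟩ | rfl
            · exact Or.inr ⟨k', hk, rfl⟩
            · exact Or.inl rfl
          · rintro (rfl | ⟨k', hk', rfl⟩)
            · exact hlast
            · exact hk'
        rw [this, card_insert_of_notMem (by simp [Fin.castSucc_ne_last]), card_map]
      rw [hcard, pow_succ]
      calc (pi fun _ : Fin N => μ).ex (fun g => μ.ex fun a =>
              if ∀ j ∈ U, F j (Fin.snoc g a) then (1 : ℝ) else 0)
          ≤ (pi fun _ : Fin N => μ).ex (fun g =>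
              (if ∀ j' ∈ U', F' j' g then (1 : ℝ) else 0) * q) := by
            refine (pi fun _ : Fin N => μ).ex_mono fun g => ?_
            by_cases hg : ∀ j' ∈ U', F' j' g
            · rw [if_pos hg, one_mul]
              have := hcond _ hlast (Fin.snoc g a₀)
              rw [pr_eq_ex] at this
              refine le_trans (μ.ex_mono fun a => ?_) this
              simp only [Fin.update_snoc_last]
              split_ifs with h1 h2
              · rfl
              · exact absurd (h1 _ hlast) h2
              · norm_num
              · rfl
            · rw [if_neg hg, zero_mul]
              refine (μ.ex_mono (h := fun _ => 0) fun a => ?_).trans (μ.ex_const 0).le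
              rw [if_neg]
              intro hall
              apply hg
              intro j' hj'
              simp only [hU', mem_filter, mem_univ, true_and] at hj'
              exact (hfreeze g a j').1 (hall _ hj')
        _ = (pi fun _ : Fin N => μ).pr (fun g => ∀ j' ∈ U', F' j' g) * q := by
            rw [pr_eq_ex]
            unfold ex
            rw [sum_mul]
            exact sum_congr rfl fun g _ => by ring
        _ ≤ q ^ U'.card * q := mul_le_mul_of_nonneg_right hIH hq
    · -- the last coordinate is irrelevant
      have hcard : U.card = U'.card := by
        have : U = U'.map Fin.castSuccEmb := by
          ext k
          simp only [mem_map, hU', mem_filter, mem_univ, true_and, Fin.castSuccEmb_apply]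
          constructor
          · intro hk
            rcases Fin.eq_castSucc_or_eq_last k with ⟨k', rfl⟩ | rfl
            · exact ⟨k', hk, rfl⟩
            · exact absurd hk hlast
          · rintro ⟨k', hk', rfl⟩; exact hk'
        rw [this, card_map]
      rw [hcard]
      calc (pi fun _ : Fin N => μ).ex (fun g => μ.ex fun a =>
              if ∀ j ∈ U, F j (Fin.snoc g a) then (1 : ℝ) else 0)
          ≤ (pi fun _ : Fin N => μ).ex (fun g => if ∀ j' ∈ U', F' j' g then (1 : ℝ) else 0) := by
            refine (pi fun _ : Fin N => μ).ex_mono fun g => μ.ex_le_of_le fun a => ?_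
            split_ifs with h1 h2
            · rfl
            · exfalso; apply h2
              intro j' hj'
              simp only [hU', mem_filter, mem_univ, true_and] at hj'
              exact (hfreeze g a j').1 (h1 _ hj')
            · norm_num
            · rfl
        _ = (pi fun _ : Fin N => μ).pr (fun g => ∀ j' ∈ U', F' j' g) := by rw [pr_eq_ex]
        _ ≤ q ^ U'.card := hIH

end Seq

/-! ### The Chernoff bound for independent bits -/

section Chernoff

variable {ι : Type*} [Fintype ι] [DecidableEq ι] {κ : Type*} [Fintype κ]

/-- **Chernoff bound (exponential moment method).** For independent coordinates and bits
`b i` with success probabilities `≤ p` on a set `S` of coordinates, the number of successes in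
`S` is at least `k` with probability at most `e^{-λk} (1 + p (e^λ - 1))^{|S|}` for every
`λ ≥ 0`. [folklore] -/
theorem pr_card_le_exp (μ : ι → FinProb κ) (S : Finset ι) (b : ι → κ → Bool) {p : ℝ}
    (hp : ∀ i ∈ S, (μ i).pr (fun a => b i a = true) ≤ p) {lam : ℝ} (hlam : 0 ≤ lam) (k : ℕ) :
    (pi μ).pr (fun f => k ≤ (S.filter fun i => b i (f i) = true).card) ≤
      Real.exp (-(lam * k)) * (1 + p * (Real.exp lam - 1)) ^ S.card := by
  classical
  -- pointwise: indicator ≤ e^{-λk} ∏_{i ∈ S} e^{λ [b i (f i)]}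
  set g : ι → κ → ℝ := fun i a => if i ∈ S then (if b i a = true then Real.exp lam else 1) else 1
    with hg
  have hgpos : ∀ i a, 0 < g i a := by
    intro i a; simp only [hg]; split_ifs <;> first | exact Real.exp_pos _ | norm_num
  have step1 : (pi μ).pr (fun f => k ≤ (S.filter fun i => b i (f i) = true).card) ≤
      (pi μ).ex fun f => Real.exp (-(lam * k)) * ∏ i, g i (f i) := by
    refine (pi μ).pr_le_ex (fun f hf => ?_)
      (fun f => mul_nonneg (Real.exp_pos _).le (prod_nonneg fun i _ => (hgpos i _).le))
    -- ∏ i, g i (f i) = exp(lam * count)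
    have hprod : ∏ i, g i (f i) = Real.exp lam ^ (S.filter fun i => b i (f i) = true).card := by
      simp only [hg]
      rw [prod_ite_mem, univ_inter, prod_ite, prod_const_one, mul_one, prod_const]
    rw [hprod, ← Real.exp_nat_mul, ← Real.exp_add]
    apply Real.one_le_exp
    have : (k : ℝ) ≤ (S.filter fun i => b i (f i) = true).card := by exact_mod_cast hf
    nlinarith
  refine step1.trans ?_
  rw [(pi μ).ex_mul_left, ex_pi_prod]
  refine mul_le_mul_of_nonneg_left ?_ (Real.exp_pos _).le
  -- each factor
  have hfac : ∀ i, (μ i).ex (g i) = if i ∈ S then 1 + (μ i).pr (fun a => b i a = true) *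
      (Real.exp lam - 1) else 1 := by
    intro i
    by_cases hi : i ∈ S
    · have hpt : ∀ a, g i a = (Real.exp lam - 1) * (if b i a = true then 1 else 0) + 1 := by
        intro a
        simp only [hg, hi, if_true]
        split_ifs <;> ring
      rw [if_pos hi]
      calc (μ i).ex (g i)
          = (μ i).ex (fun a => (Real.exp lam - 1) * (if b i a = true then 1 else 0) + 1) := by
            congr 1; funext a; exact hpt a
        _ = (Real.exp lam - 1) * (μ i).pr (fun a => b i a = true) + 1 := by
            rw [ex_add, ex_mul_left, ex_const, pr_eq_ex]
        _ = 1 + (μ i).pr (fun a => b i a = true) * (Real.exp lam - 1) := by ring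
    · simp only [hg, hi, if_false]
      exact (μ i).ex_const 1
  rw [Fintype.prod_congr _ _ hfac, prod_ite_mem, univ_inter]
  have he1 : 0 ≤ Real.exp lam - 1 := by linarith [Real.one_le_exp hlam]
  calc ∏ i ∈ S, (1 + (μ i).pr (fun a => b i a = true) * (Real.exp lam - 1))
      ≤ ∏ _i ∈ S, (1 + p * (Real.exp lam - 1)) := by
        apply prod_le_prod
        · intro i _
          have := (μ i).pr_nonneg (fun a => b i a = true)
          positivity
        · intro i hi
          nlinarith [hp i hi]
    _ = (1 + p * (Real.exp lam - 1)) ^ S.card := prod_const _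

/-- **Chernoff bound at `λ = log 2`**: at least `k` successes among bits of probability `≤ p`
on `S` happen with probability at most `2^{-k} e^{p |S|}`. With `k ≥ 2p|S|` this is at most
`e^{-(2 log 2 - 1) p |S|} ≤ e^{-p|S|/3}`, the form of [Garlík 2019, Lemma 10].
[cite: Garlik2019, Lemma 10 (proof: "By the Chernoff bound")] -/
theorem pr_card_le_half_pow (μ : ι → FinProb κ) (S : Finset ι) (b : ι → κ → Bool) {p : ℝ}
    (hp0 : 0 ≤ p) (hp : ∀ i ∈ S, (μ i).pr (fun a => b i a = true) ≤ p) (k : ℕ) :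
    (pi μ).pr (fun f => k ≤ (S.filter fun i => b i (f i) = true).card) ≤
      (1 / 2) ^ k * Real.exp (p * S.card) := by
  have h := pr_card_le_exp μ S b hp (Real.log_nonneg one_le_two) k
  rw [Real.exp_log two_pos] at h
  refine h.trans ?_
  have h1 : Real.exp (-(Real.log 2 * k)) = (1 / 2) ^ k := by
    rw [show -(Real.log 2 * k) = (k : ℝ) * (-Real.log 2) by ring, Real.exp_nat_mul, Real.exp_neg,
      Real.exp_log two_pos]
    norm_num
  rw [h1]
  refine mul_le_mul_of_nonneg_left ?_ (by positivity)
  calc (1 + p * (2 - 1)) ^ S.card = (1 + p) ^ S.card := by ring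
    _ ≤ Real.exp p ^ S.card := by
        apply pow_le_pow_left₀ (by linarith)
        have := Real.add_one_le_exp p
        linarith
    _ = Real.exp (p * S.card) := by rw [← Real.exp_nat_mul]; ring_nf

end Chernoff

end FinProb

end LevelledRefCNF

end Literature.Computability.MetaComplexity
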